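import Literature.NumberTheory.EllipticCurves.TunnellThmTwoOrdinaryProofs
import Literature.NumberTheory.EllipticCurves.TunnellThetaCoefficients
import HarnessLib

/-!
# The Hecke character of `η(12z)²` on `ℤ[i]` and its norm sums — arithmetic input for
# Tunnell's Theorem 2 for `g(θ₂ - θ₈)`

In the proof of Theorem 2 of Tunnell 1983 (pp. 327–328) the eigenvalues of the `T(p²)` on the
eigenform `g(θ₂ - θ₈) = 2 η(8z) η(32z)² ∈ S_{3/2}(128, 1)` are identified with `a_p(E)`,
`E : y² = x³ - x`, via Shimura's correspondence. The tree's elementary replacement expands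
`η(8z) η(32z)²` by Euler's pentagonal theorem, `η(24z) = ∑ χ₁₂(n) q^{n²}`, and needs the
multiplicative structure of the coefficients of
`η(12z)² = ∑_{a, b ≥ 1} χ₁₂(a) χ₁₂(b) q^{(a²+b²)/2}`. Writing `a = c - d`, `b = c + d` the weight
`χ₁₂(a)χ₁₂(b) = χ₁₂(c² - d²)` is the value at `δ = c + d i` of `χ' · Re ω`, where
`χ'` is the non-trivial character of `(ℤ[i]/2)ˣ` (`xiTwo`) and `ω` the character of order `4`
of `(ℤ[i]/3)ˣ = 𝔽₉ˣ` with `ω(1+i) = i` (`xiThree`); the product `ξ = χ' ω` (`xiSix`) is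
trivial on the units (`ξ(i) = (-1)(-1) = 1`), i.e. a Hecke character of `ℚ(i)` of conductor `(6)`,
and `η(12z)² = ∑_𝔞 ξ(𝔞) q^{N𝔞}`. This file proves, by unique factorisation in `ℤ[i]` (the tree's
primary elements, `GaussianPrimary`):

* `xiSix_mul`, `xiSix_star`, `xiSix_of_isUnit`: `ξ` is multiplicative, commutes with conjugation,
  is trivial on units (finite residue tables, `decide`);
* `zp M = ∑_{y primary, N y = M} ξ(y)` (`= ∑_{N𝔞 = M} ξ(𝔞)`): multiplicative on coprime odd
  arguments (`zp_mul_of_coprime`), real (`star_zp`), zero for `M ≡ 2 (mod 3)`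
  (`zp_eq_zero_of_mod_three`), `Z(p²) = Z(p)² - 1` at split and `Z(p²) = 1`, `Z(p) = 0` at inert
  primes (`zp_prime_sq_of_mod_four_eq_one/three`) — the Euler factors of `η(12z)²`;
* the real avatar `xiG M = ∑_{N δ = M, δ ≡ 1 (3)} χ'(δ)` (`= Z(M)` for `M ≡ 1 (mod 6)`,
  `zp_eq_xiG`) with the consequences used downstream: `xiG_mul`, `xiG_mul_eq_zero`,
  `xiG_prime_sq_of_mod_four_eq_one(')`, `xiG_prime_sq_of_mod_four_eq_three`,
  `xiG_prime_of_mod_four_eq_three`;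
* the bridge to theta coefficients: `∑_{(6l₁+1)² + (6l₂+1)² = 2M} (-1)^{l₁+l₂} = Ξ(M)` for odd
  `M` (`sum_box_eq_xiG`), i.e. `[q^M] η(12z)² = Ξ(M)`.

No named facts; the definitions are finite tables and finite sums. Everything is declared in the
grouping namespace `Literature.NumberTheory.EllipticCurves.Tunnell1983.HeckeXi` (this file's path),
opening `GaussianPrimary` for the primary elements.

## References

* J. B. Tunnell, *A classical Diophantine problem and modular forms of weight 3/2*, Invent. Math.
  72 (1983) 323–334, Thm 2 and its proof, pp. 327–328. [Tunnell1983Congruent]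
* K. Ireland, M. Rosen, *A Classical Introduction to Modern Number Theory*, GTM 84, Ch. 9 §7
  (primary Gaussian integers), Ch. 18 §6 (Hecke `L`-series of `ℚ(i)`). [IrelandRosen1990]
-/

namespace Literature.NumberTheory.EllipticCurves.Tunnell1983.HeckeXi

local notation "ℤ[i]" => GaussianInt

open Zsqrtd Finset
open Literature.NumberTheory.QuadraticFields.GaussianPrimary
open Literature.NumberTheory.LFunctions.GaussianTheta (normEq mem_normEq)

/-! ### The characters `χ'` (mod `2`), `ω` (mod `3`) and `ξ = χ' ω` (mod `6`) on `ℤ[i]` -/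

/-- The table of `χ'` on residues modulo `2`: `+1` at `1`, `-1` at `i`, `0` at `0, 1+i`.
[folklore] -/
def xiTwoZ (a b : ZMod 2) : ℤ := if a = 1 ∧ b = 0 then 1 else if a = 0 ∧ b = 1 then -1 else 0

/-- `χ'(x)`: the non-trivial character of `(ℤ[i]/2)ˣ = {1, i}` extended by `0`
(`χ'(c + di) = χ₋₄(c² - d²)`). [folklore] -/
def xiTwo (x : ℤ[i]) : ℤ := xiTwoZ x.re x.im

/-- `χ'` is multiplicative (table check). [folklore] -/
theorem xiTwoZ_mul (a b c d : ZMod 2) :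
    xiTwoZ (a * c - b * d) (a * d + b * c) = xiTwoZ a b * xiTwoZ c d := by
  revert a b c d; decide

/-- `χ'` is even in the imaginary part. [folklore] -/
theorem xiTwoZ_neg (a b : ZMod 2) : xiTwoZ a (-b) = xiTwoZ a b := by
  revert a b; decide

/-- The table of `ω` on `𝔽₉ = ℤ[i]/3`: `1` at `±1`, `-1` at `±i`, `i` at `±(1+i)`, `-i` at
`±(1-i)`, `0` at `0`. [folklore] -/
def xiThreeZ (a b : ZMod 3) : ℤ[i] :=
  if b = 0 then (if a = 0 then 0 else 1)
  else if a = 0 then -1 else if a = b then ⟨0, 1⟩ else ⟨0, -1⟩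

/-- `ω(x)`: the character of order `4` of `(ℤ[i]/3)ˣ` with `ω(1 + i) = i` (so `ω(i) = -1`),
extended by `0`, with values in `ℤ[i]`. [folklore] -/
def xiThree (x : ℤ[i]) : ℤ[i] := xiThreeZ x.re x.im

/-- `ω` is multiplicative (table check over `𝔽₉ × 𝔽₉`). [folklore] -/
theorem xiThreeZ_mul (a b c d : ZMod 3) :
    xiThreeZ (a * c - b * d) (a * d + b * c) = xiThreeZ a b * xiThreeZ c d := by
  revert a b c d; decide

/-- `ω(x̄) = ω(x)‾`. [folklore] -/
theorem xiThreeZ_neg (a b : ZMod 3) : xiThreeZ a (-b) = star (xiThreeZ a b) := by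
  revert a b; decide

/-- `Re ω = 0` on elements of norm `≡ 2 (mod 3)` (the generators of `𝔽₉ˣ`). [folklore] -/
theorem xiThreeZ_re (a b : ZMod 3) (h : a * a + b * b = 2) : (xiThreeZ a b).re = 0 := by
  revert a b; decide

/-- `Im ω = 0` on elements of norm `≡ 1 (mod 3)` (the subgroup `{±1, ±i}`). [folklore] -/
theorem xiThreeZ_im (a b : ZMod 3) (h : a * a + b * b = 1) : (xiThreeZ a b).im = 0 := by
  revert a b; decide

/-- `χ'(xy) = χ'(x) χ'(y)`. [folklore] -/
theorem xiTwo_mul (x y : ℤ[i]) : xiTwo (x * y) = xiTwo x * xiTwo y := by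
  rw [xiTwo, xiTwo, xiTwo, Zsqrtd.re_mul, Zsqrtd.im_mul, ← xiTwoZ_mul]
  push_cast
  ring_nf

/-- `ω(xy) = ω(x) ω(y)`. [folklore] -/
theorem xiThree_mul (x y : ℤ[i]) : xiThree (x * y) = xiThree x * xiThree y := by
  rw [xiThree, xiThree, xiThree, Zsqrtd.re_mul, Zsqrtd.im_mul, ← xiThreeZ_mul]
  push_cast
  ring_nf

/-- `ξ(x) = χ'(x) ω(x)`: the Hecke character of `ℚ(i)` of conductor `(6)` attached to `η(12z)²`,
on elements, with values in `{0, ±1, ±i} ⊂ ℤ[i]`. [folklore] -/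
def xiSix (x : ℤ[i]) : ℤ[i] := (xiTwo x : ℤ[i]) * xiThree x

/-- `ξ(xy) = ξ(x) ξ(y)`. [folklore] -/
theorem xiSix_mul (x y : ℤ[i]) : xiSix (x * y) = xiSix x * xiSix y := by
  rw [xiSix, xiSix, xiSix, xiTwo_mul, xiThree_mul]
  push_cast
  ring

/-- `ξ(x̄) = ξ(x)‾`. [folklore] -/
theorem xiSix_star (x : ℤ[i]) : xiSix (star x) = star (xiSix x) := by
  rw [xiSix, xiSix, xiTwo, xiThree, Zsqrtd.re_star, Zsqrtd.im_star, xiTwo, xiThree]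
  push_cast
  rw [xiTwoZ_neg, xiThreeZ_neg, star_mul', star_intCast]

/-- `ξ(1) = 1`. [folklore] -/
theorem xiSix_one : xiSix 1 = 1 := by decide

/-- `ξ(-1) = 1`. [folklore] -/
theorem xiSix_neg_one : xiSix (-1) = 1 := by decide

/-- `ξ(i) = 1` (`χ'(i) = -1 = ω(i)`). [folklore] -/
theorem xiSix_I : xiSix ⟨0, 1⟩ = 1 := by decide

/-- `ξ(-i) = 1`. [folklore] -/
theorem xiSix_neg_I : xiSix ⟨0, -1⟩ = 1 := by decide

/-! ### Residues -/

/-- Casting a residue `0 (mod 3)`. [folklore] -/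
theorem intCast_zmod_three_eq_zero {a : ℤ} (h : a % 3 = 0) : (a : ZMod 3) = 0 := by
  rw [show a = 3 * (a / 3) by omega]; push_cast
  rw [show (3 : ZMod 3) = 0 from rfl, zero_mul]

/-- Casting a residue `1 (mod 3)`. [folklore] -/
theorem intCast_zmod_three_eq_one {a : ℤ} (h : a % 3 = 1) : (a : ZMod 3) = 1 := by
  rw [show a = 3 * (a / 3) + 1 by omega]; push_cast
  rw [show (3 : ZMod 3) = 0 from rfl, zero_mul, zero_add]

/-- Casting a residue `2 (mod 3)`. [folklore] -/
theorem intCast_zmod_three_eq_two {a : ℤ} (h : a % 3 = 2) : (a : ZMod 3) = 2 := by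
  rw [show a = 3 * (a / 3) + 2 by omega]; push_cast
  rw [show (3 : ZMod 3) = 0 from rfl, zero_mul, zero_add]

/-- Casting a residue `0 (mod 2)`. [folklore] -/
theorem intCast_zmod_two_eq_zero {a : ℤ} (h : a % 2 = 0) : (a : ZMod 2) = 0 := by
  rw [show a = 2 * (a / 2) by omega]; push_cast
  rw [show (2 : ZMod 2) = 0 from rfl, zero_mul]

/-- Casting a residue `1 (mod 2)`. [folklore] -/
theorem intCast_zmod_two_eq_one {a : ℤ} (h : a % 2 = 1) : (a : ZMod 2) = 1 := by
  rw [show a = 2 * (a / 2) + 1 by omega]; push_cast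
  rw [show (2 : ZMod 2) = 0 from rfl, zero_mul, zero_add]

/-- `N(x) = re² + im²` cast to `ZMod 3`. [folklore] -/
theorem cast_norm_zmod_three (x : ℤ[i]) :
    ((x.norm : ℤ) : ZMod 3) = (x.re : ZMod 3) * x.re + (x.im : ZMod 3) * x.im := by
  rw [Zsqrtd.norm_def]; push_cast; ring

/-- `ξ(x) = χ'(x)` on `x ≡ 1 (mod 3)`. [folklore] -/
theorem xiSix_of_mod_three {x : ℤ[i]} (hre : x.re % 3 = 1) (him : x.im % 3 = 0) :
    xiSix x = (xiTwo x : ℤ[i]) := by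
  rw [xiSix, xiThree, intCast_zmod_three_eq_one hre, intCast_zmod_three_eq_zero him,
    show xiThreeZ 1 0 = 1 from rfl, mul_one]

/-- `Re ξ(x) = 0` when `N(x) ≡ 2 (mod 3)` (then `ω(x) = ±i`). [folklore] -/
theorem xiSix_re_eq_zero {x : ℤ[i]} (h : x.norm % 3 = 2) : (xiSix x).re = 0 := by
  have h2 : (x.re : ZMod 3) * x.re + (x.im : ZMod 3) * x.im = 2 := by
    rw [← cast_norm_zmod_three, intCast_zmod_three_eq_two h]
  rw [xiSix, Zsqrtd.re_mul, Zsqrtd.re_intCast, Zsqrtd.im_intCast, xiThree, xiThreeZ_re _ _ h2]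
  ring

/-- `Im ξ(x) = 0` when `N(x) ≡ 1 (mod 3)` (then `ω(x) = ±1`). [folklore] -/
theorem xiSix_im_eq_zero {x : ℤ[i]} (h : x.norm % 3 = 1) : (xiSix x).im = 0 := by
  have h1 : (x.re : ZMod 3) * x.re + (x.im : ZMod 3) * x.im = 1 := by
    rw [← cast_norm_zmod_three, intCast_zmod_three_eq_one h]
  rw [xiSix, Zsqrtd.im_mul, Zsqrtd.re_intCast, Zsqrtd.im_intCast, xiThree, xiThreeZ_im _ _ h1]
  ring

/-- `ξ` is trivial on units (`ξ(i) = χ'(i) ω(i) = (-1)(-1) = 1`). [folklore] -/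
theorem xiSix_of_isUnit {u : ℤ[i]} (hu : IsUnit u) : xiSix u = 1 := by
  rcases eq_of_isUnit hu with rfl | rfl | rfl | rfl
  · exact xiSix_one
  · exact xiSix_neg_one
  · exact xiSix_I
  · exact xiSix_neg_I

/-- `ξ(u x) = ξ(x)` for a unit `u`. [folklore] -/
theorem xiSix_isUnit_mul {u : ℤ[i]} (hu : IsUnit u) (x : ℤ[i]) : xiSix (u * x) = xiSix x := by
  rw [xiSix_mul, xiSix_of_isUnit hu, one_mul]

/-- `ξ(n) = 1` for a natural `n` prime to `6`. [folklore] -/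
theorem xiSix_natCast {n : ℕ} (h2 : n % 2 = 1) (h3 : n % 3 ≠ 0) : xiSix n = 1 := by
  have hre : ((n : ℤ[i])).re = n := Zsqrtd.re_natCast n
  have him : ((n : ℤ[i])).im = 0 := Zsqrtd.im_natCast n
  rw [xiSix, xiTwo, xiThree, hre, him]
  have h2' : ((n : ℤ) : ZMod 2) = 1 := intCast_zmod_two_eq_one (by omega)
  rw [h2', Int.cast_zero, Int.cast_zero, show xiTwoZ 1 0 = 1 from rfl, Int.cast_one, one_mul]
  rcases (show (n : ℤ) % 3 = 1 ∨ (n : ℤ) % 3 = 2 by omega) with h | h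
  · rw [intCast_zmod_three_eq_one h]; rfl
  · rw [intCast_zmod_three_eq_two h]; rfl

/-- A prime other than `3` is not divisible by `3`. [folklore] -/
theorem prime_mod_three_ne_zero {p : ℕ} (hp : p.Prime) (h3 : p ≠ 3) : p % 3 ≠ 0 := by
  intro h
  have hd : 3 ∣ p := Nat.dvd_of_mod_eq_zero h
  rcases hp.eq_one_or_self_of_dvd 3 hd with h1 | h1
  · norm_num at h1
  · exact h3 h1.symm

/-! ### The sums `Z(M) = ∑_{y primary, N y = M} ξ(y)` (the coefficients of `η(12z)²`) -/

/-- `Z(M) = ∑_{y primary, N(y) = M} ξ(y)`: the sum of the Hecke character `ξ` over the ideals of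
odd norm `M` (one primary generator per ideal) — the `M`-th coefficient of
`η(12z)² = ∑ ξ(𝔞) q^{N𝔞}`. [folklore] -/
def zp (M : ℕ) : ℤ[i] := ∑ y ∈ primaryNormEq M, xiSix y

/-- **Multiplicativity**: `Z(m m') = Z(m) Z(m')` for coprime odd `m, m'` — `(y, z) ↦ y z` is a
bijection between pairs of primary elements of norms `m, m'` and primary elements of norm `m m'`
(unique factorisation in `ℤ[i]`), and `ξ` is multiplicative. [folklore] -/
theorem zp_mul_of_coprime {m m' : ℕ} (hm : m % 2 = 1) (hm' : m' % 2 = 1) (h : m.Coprime m') :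
    zp (m * m') = zp m * zp m' := by
  rw [zp, zp, zp, Finset.sum_mul_sum, ← Finset.sum_product']
  symm
  refine Finset.sum_bij (fun p _ ↦ p.1 * p.2) ?_ ?_ ?_ (fun p _ ↦ (xiSix_mul p.1 p.2).symm)
  · rintro ⟨y, z⟩ hp
    rw [Finset.mem_product] at hp
    obtain ⟨hy, hyp⟩ := mem_primaryNormEq.mp hp.1
    obtain ⟨hz, hzp⟩ := mem_primaryNormEq.mp hp.2
    refine mem_primaryNormEq.mpr ⟨?_, hyp.mul hzp⟩
    rw [Zsqrtd.norm_mul, hy, hz, Nat.cast_mul]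
  · rintro ⟨y, z⟩ hp ⟨y', z'⟩ hp' hyz
    simp only at hyz
    rw [Finset.mem_product] at hp hp'
    obtain ⟨hy, hyp⟩ := mem_primaryNormEq.mp hp.1
    obtain ⟨hz, hzp⟩ := mem_primaryNormEq.mp hp.2
    obtain ⟨hy', hyp'⟩ := mem_primaryNormEq.mp hp'.1
    obtain ⟨hz', hzp'⟩ := mem_primaryNormEq.mp hp'.2
    have hc : IsCoprime y z' := isCoprime_of_norm_coprime h hy hz'
    have hc' : IsCoprime y' z := isCoprime_of_norm_coprime h hy' hz
    have h1 : y ∣ y' := hc.dvd_of_dvd_mul_right ⟨z, by rw [← hyz, mul_comm]⟩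
    have h2 : y' ∣ y := hc'.dvd_of_dvd_mul_right ⟨z', by rw [hyz, mul_comm]⟩
    have hyy' : y = y' := hyp.eq_of_associated hyp' (associated_of_dvd_dvd h1 h2)
    subst hyy'
    have hzz' : z = z' := mul_left_cancel₀ hyp.ne_zero hyz
    subst hzz'
    rfl
  · intro x hx
    obtain ⟨hxn, hxp⟩ := mem_primaryNormEq.mp hx
    have hm0 : m ≠ 0 := by omega
    obtain ⟨α, β, hα, hβ, hαβ⟩ := exists_mul_eq_of_coprime h hm0 (γ := x)
      (by rw [hxn]; push_cast; ring)
    have hαodd : (α.re + α.im) % 2 = 1 := parity_of_norm_odd hm hα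
    have hβodd : (β.re + β.im) % 2 = 1 := parity_of_norm_odd hm' hβ
    refine ⟨(primary α, primary β), ?_, ?_⟩
    · rw [Finset.mem_product]
      exact ⟨mem_primaryNormEq.mpr ⟨by rw [norm_primary hαodd, hα], isPrimary_primary hαodd⟩,
        mem_primaryNormEq.mpr ⟨by rw [norm_primary hβodd, hβ], isPrimary_primary hβodd⟩⟩
    · show primary α * primary β = x
      rw [← primary_mul, hαβ, primary_of_isPrimary hxp]

/-- `Z(M)` is real: `Z(M)‾ = Z(M)` (conjugation permutes the primary elements of norm `M`, and
`ξ(ȳ) = ξ(y)‾`). [folklore] -/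
theorem star_zp (M : ℕ) : star (zp M) = zp M := by
  rw [zp, star_sum]
  refine Finset.sum_nbij' star star ?_ ?_ (fun x _ ↦ star_star x) (fun x _ ↦ star_star x)
    (fun x _ ↦ (xiSix_star x).symm)
  · intro x hx
    obtain ⟨hxn, hxp⟩ := mem_primaryNormEq.mp hx
    exact mem_primaryNormEq.mpr ⟨by rw [Zsqrtd.norm_conj, hxn], hxp.star⟩
  · intro x hx
    obtain ⟨hxn, hxp⟩ := mem_primaryNormEq.mp hx
    exact mem_primaryNormEq.mpr ⟨by rw [Zsqrtd.norm_conj, hxn], hxp.star⟩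

/-- `Im Z(M) = 0`. [folklore] -/
theorem zp_im (M : ℕ) : (zp M).im = 0 := by
  have h := congrArg Zsqrtd.im (star_zp M)
  rw [Zsqrtd.im_star] at h
  omega

/-- `Re Z(M) = 0` for `M ≡ 2 (mod 3)` (every term has `Re ξ = 0`). [folklore] -/
theorem zp_re_of_mod_three {M : ℕ} (hM : M % 3 = 2) : (zp M).re = 0 := by
  rw [zp, Literature.NumberTheory.EllipticCurves.Tunnell1983.re_sum]
  refine Finset.sum_eq_zero fun y hy ↦ ?_
  obtain ⟨hyn, -⟩ := mem_primaryNormEq.mp hy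
  exact xiSix_re_eq_zero (by rw [hyn]; omega)

/-- **`Z(M) = 0` for `M ≡ 2 (mod 3)`** (the ideals of norm `M` pair off under conjugation with
opposite values of `ξ`). [folklore] -/
theorem zp_eq_zero_of_mod_three {M : ℕ} (hM : M % 3 = 2) : zp M = 0 :=
  Zsqrtd.ext (zp_re_of_mod_three hM) (zp_im M)

/-- `Z(p) = 0` at an inert prime `p ≡ 3 (mod 4)`. [folklore] -/
theorem zp_prime_of_mod_four_eq_three {p : ℕ} (hp : p.Prime) (hp3 : p % 4 = 3) : zp p = 0 := by
  haveI := Fact.mk hp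
  have h := (primaryNormEq_pow_of_mod_four_eq_three (p := p) hp3 0).2
  rw [mul_zero, zero_add, pow_one] at h
  rw [zp, h, Finset.sum_empty]

/-- `Z(p²) = 1` at an inert prime `p ≡ 3 (mod 4)`, `p ≠ 3` (the only ideal is `(p)`,
`ξ((p)) = 1`). [folklore] -/
theorem zp_prime_sq_of_mod_four_eq_three {p : ℕ} (hp : p.Prime) (hp3 : p % 4 = 3) (h3 : p ≠ 3) :
    zp (p ^ 2) = 1 := by
  haveI := Fact.mk hp
  have h := (primaryNormEq_pow_of_mod_four_eq_three (p := p) hp3 1).1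
  rw [mul_one, pow_one] at h
  rw [zp, h, Finset.sum_singleton, show (-(p : ℤ[i])) = (-1) * p by ring,
    xiSix_isUnit_mul isUnit_one.neg, xiSix_natCast (by omega) (prime_mod_three_ne_zero hp h3)]

/-- **`Z(p²) = Z(p)² - 1` at a split prime `p ≡ 1 (mod 4)`** (`p = π π̄`:
`Z(p) = ξ(π) + ξ(π̄)`, `Z(p²) = ξ(π)² + ξ(π)ξ(π̄) + ξ(π̄)²`, `ξ(π)ξ(π̄) = ξ(p) = 1`) — the Hecke
relation `a(p²) = a(p)² - χ₋₄(p)` of the newform `η(12z)²`. [folklore] -/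
theorem zp_prime_sq_of_mod_four_eq_one {p : ℕ} (hp : p.Prime) (hp1 : p % 4 = 1) :
    zp (p ^ 2) = zp p ^ 2 - 1 := by
  haveI := Fact.mk hp
  obtain ⟨π, hπ, hπn⟩ := exists_isPrimary_norm_eq (p := p) hp1
  have h1 := primaryNormEq_pow_of_mod_four_eq_one hp hπ hπn 1
  have h2 := primaryNormEq_pow_of_mod_four_eq_one hp hπ hπn 2
  rw [pow_one] at h1
  have e1 : zp p = xiSix (star π) + xiSix π := by
    rw [zp, h1, Finset.sum_image (injOn_pow_mul_pow hp hp1 hπn 1)]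
    simp only [Finset.sum_range_succ, Finset.sum_range_zero, zero_add, pow_zero, pow_one,
      one_mul, mul_one, Nat.sub_zero, Nat.sub_self]
  have e2 : zp (p ^ 2) = xiSix (star π) ^ 2 + xiSix π * xiSix (star π) + xiSix π ^ 2 := by
    rw [zp, h2, Finset.sum_image (injOn_pow_mul_pow hp hp1 hπn 2)]
    simp only [Finset.sum_range_succ, Finset.sum_range_zero, zero_add, pow_zero, pow_one,
      one_mul, mul_one, Nat.sub_zero, Nat.sub_self, show 2 - 1 = 1 from rfl]
    simp only [pow_two, xiSix_mul]
  have e3 : xiSix π * xiSix (star π) = 1 := by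
    rw [← xiSix_mul, ← natCast_eq_mul_star hπn,
      xiSix_natCast (by omega) (prime_mod_three_ne_zero hp (by omega))]
  rw [e1, e2]
  linear_combination (-1 : ℤ[i]) * e3

/-! ### The real form: `Ξ(M) = ∑_{N δ = M, δ ≡ 1 (3)} χ'(δ)` -/

/-- The elements of norm `M` congruent to `1` modulo `3`. [folklore] -/
noncomputable def gSet (M : ℕ) : Finset ℤ[i] := (normEq M).filter fun δ ↦ δ.re % 3 = 1 ∧ δ.im % 3 = 0

/-- `Ξ(M) = ∑_{N(δ) = M, δ ≡ 1 (mod 3)} χ'(δ)`: for `M ≡ 1 (mod 6)` the `M`-th coefficient of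
`η(12z)²` (`zp_eq_xiG`). [folklore] -/
noncomputable def xiG (M : ℕ) : ℤ := ∑ δ ∈ gSet M, xiTwo δ

/-- The associate of `y` congruent to `1` modulo `3` (when `N(y) ≡ 1 (mod 3)`). [folklore] -/
def repG (y : ℤ[i]) : ℤ[i] :=
  if y.im % 3 = 0 then (if y.re % 3 = 1 then y else -y)
  else (if y.im % 3 = 1 then -(⟨0, 1⟩ * y) else ⟨0, 1⟩ * y)

/-- `repG y = u y` for a unit `u`. [folklore] -/
theorem exists_isUnit_repG_eq (y : ℤ[i]) : ∃ u : ℤ[i], IsUnit u ∧ repG y = u * y := by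
  unfold repG
  split_ifs
  · exact ⟨1, isUnit_one, (one_mul y).symm⟩
  · exact ⟨-1, isUnit_one.neg, by ring⟩
  · exact ⟨-⟨0, 1⟩, isUnit_I.neg, by ring⟩
  · exact ⟨⟨0, 1⟩, isUnit_I, rfl⟩

/-- Squares modulo `3`. [folklore] -/
theorem sq_mod_three (a : ℤ) : (a % 3 = 0 ∧ a * a % 3 = 0) ∨ (a % 3 ≠ 0 ∧ a * a % 3 = 1) := by
  rcases (show a % 3 = 0 ∨ a % 3 = 1 ∨ a % 3 = 2 by omega) with h | h | h
  · left; refine ⟨h, ?_⟩; rw [Int.mul_emod, h]; norm_num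
  · right; refine ⟨by omega, ?_⟩; rw [Int.mul_emod, h]; norm_num
  · right; refine ⟨by omega, ?_⟩; rw [Int.mul_emod, h]; norm_num

/-- `a² + b² ≡ 1 (mod 3)` forces exactly one of `a, b` to be divisible by `3`. [folklore] -/
theorem sq_add_sq_mod_three {a b : ℤ} (h : (a * a + b * b) % 3 = 1) :
    (a % 3 = 0 ∧ (b % 3 = 1 ∨ b % 3 = 2)) ∨ (b % 3 = 0 ∧ (a % 3 = 1 ∨ a % 3 = 2)) := by
  have ha := sq_mod_three a
  have hb := sq_mod_three b
  generalize a * a = s at h ha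
  generalize b * b = t at h hb
  omega

/-- `repG y ≡ 1 (mod 3)` when `N(y) ≡ 1 (mod 3)`. [folklore] -/
theorem repG_mod_three {y : ℤ[i]} (hy : y.norm % 3 = 1) :
    (repG y).re % 3 = 1 ∧ (repG y).im % 3 = 0 := by
  have hn : y.re * y.re + y.im * y.im = y.norm := by rw [Zsqrtd.norm_def]; ring
  have h := sq_add_sq_mod_three (a := y.re) (b := y.im) (by rw [hn]; exact hy)
  unfold repG
  split_ifs with h1 h2 h3
  · exact ⟨h2, h1⟩
  · simp only [Zsqrtd.re_neg, Zsqrtd.im_neg]; omega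
  · simp only [Zsqrtd.re_neg, Zsqrtd.im_neg, re_I_mul, im_I_mul]; omega
  · simp only [re_I_mul, im_I_mul]; omega

/-- `i (i δ) = -δ`. [folklore] -/
theorem I_mul_I_mul (δ : ℤ[i]) : (⟨0, 1⟩ : ℤ[i]) * (⟨0, 1⟩ * δ) = -δ := by
  ext <;> simp [Zsqrtd.re_mul, Zsqrtd.im_mul]

/-- The associate congruent to `1 (mod 3)` is unique: `repG (u δ) = δ` for `δ ≡ 1 (mod 3)` and
`u` a unit. [folklore] -/
theorem repG_isUnit_mul {δ u : ℤ[i]} (hre : δ.re % 3 = 1) (him : δ.im % 3 = 0) (hu : IsUnit u) :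
    repG (u * δ) = δ := by
  rcases eq_of_isUnit hu with rfl | rfl | rfl | rfl
  · rw [one_mul]; unfold repG; rw [if_pos him, if_pos hre]
  · rw [neg_one_mul]; unfold repG
    simp only [Zsqrtd.re_neg, Zsqrtd.im_neg]
    rw [if_pos (by omega), if_neg (by omega), neg_neg]
  · unfold repG
    rw [re_I_mul, im_I_mul, if_neg (by omega), if_pos hre, I_mul_I_mul, neg_neg]
  · rw [show (⟨0, -1⟩ : ℤ[i]) * δ = -(⟨0, 1⟩ * δ) by ext <;> simp [Zsqrtd.re_mul, Zsqrtd.im_mul]]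
    unfold repG
    simp only [Zsqrtd.re_neg, Zsqrtd.im_neg, re_I_mul, im_I_mul]
    rw [if_neg (by omega), if_neg (by omega), mul_neg, I_mul_I_mul, neg_neg]

/-- **`Z(M) = Ξ(M)` for `M ≡ 1 (mod 6)`**: each primary `y` of norm `M` has exactly one associate
`δ ≡ 1 (mod 3)`, and `ξ(y) = ξ(δ) = χ'(δ)`. [folklore] -/
theorem zp_eq_xiG {M : ℕ} (hM2 : M % 2 = 1) (hM3 : M % 3 = 1) : zp M = (xiG M : ℤ[i]) := by
  rw [zp, xiG]
  push_cast
  symm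
  refine Finset.sum_nbij' primary repG ?_ ?_ ?_ ?_ ?_
  · intro δ hδ
    rw [gSet, Finset.mem_filter, mem_normEq] at hδ
    have hodd : (δ.re + δ.im) % 2 = 1 := parity_of_norm_odd hM2 hδ.1
    exact mem_primaryNormEq.mpr ⟨by rw [norm_primary hodd, hδ.1], isPrimary_primary hodd⟩
  · intro y hy
    obtain ⟨hyn, -⟩ := mem_primaryNormEq.mp hy
    obtain ⟨u, hu, hrep⟩ := exists_isUnit_repG_eq y
    have hmod := repG_mod_three (y := y) (by rw [hyn]; omega)
    rw [gSet, Finset.mem_filter, mem_normEq]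
    refine ⟨?_, hmod⟩
    rw [hrep, Zsqrtd.norm_mul, (Zsqrtd.norm_eq_one_iff' (by norm_num) u).mpr hu, one_mul, hyn]
  · intro δ hδ
    rw [gSet, Finset.mem_filter, mem_normEq] at hδ
    have hodd : (δ.re + δ.im) % 2 = 1 := parity_of_norm_odd hM2 hδ.1
    obtain ⟨u, hu, hprim⟩ := exists_isUnit_primary_eq hodd
    rw [hprim]
    exact repG_isUnit_mul hδ.2.1 hδ.2.2 hu
  · intro y hy
    obtain ⟨-, hyp⟩ := mem_primaryNormEq.mp hy
    obtain ⟨u, hu, hrep⟩ := exists_isUnit_repG_eq y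
    rw [hrep, primary_isUnit_mul hu, primary_of_isPrimary hyp]
  · intro δ hδ
    rw [gSet, Finset.mem_filter, mem_normEq] at hδ
    have hodd : (δ.re + δ.im) % 2 = 1 := parity_of_norm_odd hM2 hδ.1
    obtain ⟨u, hu, hprim⟩ := exists_isUnit_primary_eq hodd
    rw [hprim, xiSix_isUnit_mul hu, xiSix_of_mod_three hδ.2.1 hδ.2.2]

/-- **`Ξ(AB) = Ξ(A) Ξ(B)` for coprime `A ≡ B ≡ 1 (mod 6)`.** [folklore] -/
theorem xiG_mul {A B : ℕ} (hA : A % 6 = 1) (hB : B % 6 = 1) (h : A.Coprime B) :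
    xiG (A * B) = xiG A * xiG B := by
  have hAB : A * B % 6 = 1 := by rw [Nat.mul_mod, hA, hB]
  have e := zp_mul_of_coprime (by omega) (by omega) h
  rw [zp_eq_xiG (by omega) (by omega), zp_eq_xiG (by omega) (by omega),
    zp_eq_xiG (by omega) (by omega)] at e
  have := congrArg Zsqrtd.re e
  simpa [Zsqrtd.re_mul, Zsqrtd.re_intCast, Zsqrtd.im_intCast] using this

/-- **`Ξ(AB) = 0` for coprime `A ≡ B ≡ 5 (mod 6)`** (`Z(A) = 0`). [folklore] -/
theorem xiG_mul_eq_zero {A B : ℕ} (hA : A % 6 = 5) (hB : B % 6 = 5) (h : A.Coprime B) :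
    xiG (A * B) = 0 := by
  have hAB : A * B % 6 = 1 := by rw [Nat.mul_mod, hA, hB]
  have e := zp_mul_of_coprime (by omega) (by omega) h
  rw [zp_eq_zero_of_mod_three (show A % 3 = 2 by omega), zero_mul,
    zp_eq_xiG (by omega) (by omega)] at e
  have := congrArg Zsqrtd.re e
  simpa [Zsqrtd.re_intCast] using this

/-- `Ξ(p²) = 1` for a prime `p ≡ 3 (mod 4)`, `p ≠ 3`. [folklore] -/
theorem xiG_prime_sq_of_mod_four_eq_three {p : ℕ} (hp : p.Prime) (hp3 : p % 4 = 3) (h3 : p ≠ 3) :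
    xiG (p ^ 2) = 1 := by
  have hp3' := prime_mod_three_ne_zero hp h3
  have hsq : p ^ 2 % 3 = 1 := by
    rw [Nat.pow_mod]
    rcases (show p % 3 = 1 ∨ p % 3 = 2 by omega) with h | h <;> rw [h]
  have e := zp_prime_sq_of_mod_four_eq_three hp hp3 h3
  rw [zp_eq_xiG (by rw [Nat.pow_mod]; rw [show p % 2 = 1 by omega]) hsq] at e
  have := congrArg Zsqrtd.re e
  simpa [Zsqrtd.re_intCast] using this

/-- `Ξ(p) = 0` for a prime `p ≡ 3 (mod 4)`, `p ≡ 1 (mod 3)`. [folklore] -/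
theorem xiG_prime_of_mod_four_eq_three {p : ℕ} (hp : p.Prime) (hp3 : p % 4 = 3) (h1 : p % 3 = 1) :
    xiG p = 0 := by
  have e := zp_prime_of_mod_four_eq_three hp hp3
  rw [zp_eq_xiG (by omega) h1] at e
  have := congrArg Zsqrtd.re e
  simpa [Zsqrtd.re_intCast] using this

/-- **`Ξ(p²) = Ξ(p)² - 1` for a prime `p ≡ 1 (mod 4)`, `p ≡ 1 (mod 3)`.** [folklore] -/
theorem xiG_prime_sq_of_mod_four_eq_one {p : ℕ} (hp : p.Prime) (hp1 : p % 4 = 1) (h1 : p % 3 = 1) :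
    xiG (p ^ 2) = xiG p ^ 2 - 1 := by
  have hsq : p ^ 2 % 3 = 1 := by rw [Nat.pow_mod, h1]
  have e := zp_prime_sq_of_mod_four_eq_one hp hp1
  rw [zp_eq_xiG (by rw [Nat.pow_mod]; rw [show p % 2 = 1 by omega]) hsq,
    zp_eq_xiG (by omega) h1] at e
  have := congrArg Zsqrtd.re e
  simpa [Zsqrtd.re_mul, Zsqrtd.re_intCast, Zsqrtd.im_intCast, pow_two] using this

/-- **`Ξ(p²) = -1` for a prime `p ≡ 1 (mod 4)`, `p ≡ 2 (mod 3)`** (`Z(p) = 0`). [folklore] -/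
theorem xiG_prime_sq_of_mod_four_eq_one' {p : ℕ} (hp : p.Prime) (hp1 : p % 4 = 1) (h2 : p % 3 = 2) :
    xiG (p ^ 2) = -1 := by
  have hsq : p ^ 2 % 3 = 1 := by rw [Nat.pow_mod, h2]
  have e := zp_prime_sq_of_mod_four_eq_one hp hp1
  rw [zp_eq_xiG (by rw [Nat.pow_mod]; rw [show p % 2 = 1 by omega]) hsq,
    zp_eq_zero_of_mod_three h2] at e
  have := congrArg Zsqrtd.re e
  simpa [Zsqrtd.re_intCast] using this


/-! ### The bridge to theta coefficients: `∑_{(6l₁+1)² + (6l₂+1)² = 2M} (-1)^{l₁+l₂} = Ξ(M)` -/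

/-- `(-1)^{|l₁|} (-1)^{|l₂|} = (-1)^{l₁ + l₂}`. [folklore] -/
theorem neg_one_pow_natAbs_mul_natAbs (l₁ l₂ : ℤ) :
    (-1 : ℤ) ^ l₁.natAbs * (-1) ^ l₂.natAbs = if (l₁ + l₂) % 2 = 0 then 1 else -1 := by
  rw [← pow_add, neg_one_pow_eq_pow_mod_two]
  split_ifs with h
  · rw [show (l₁.natAbs + l₂.natAbs) % 2 = 0 by omega, pow_zero]
  · rw [show (l₁.natAbs + l₂.natAbs) % 2 = 1 by omega, pow_one]

/-- `χ'` at `δ = (3(l₁+l₂)+1) + 3(l₂-l₁) i` is `(-1)^{l₁+l₂}`. [folklore] -/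
theorem xiTwo_mk_eq (l₁ l₂ : ℤ) :
    xiTwo ⟨3 * (l₁ + l₂) + 1, 3 * (l₂ - l₁)⟩ = if (l₁ + l₂) % 2 = 0 then 1 else -1 := by
  rw [xiTwo]
  dsimp only
  split_ifs with h
  · rw [intCast_zmod_two_eq_one (by omega), intCast_zmod_two_eq_zero (by omega)]; rfl
  · rw [intCast_zmod_two_eq_zero (by omega), intCast_zmod_two_eq_one (by omega)]; rfl

/-- The box loses no solution of `(6l₁+1)² + (6l₂+1)² = 2M`. [folklore] -/
theorem natAbs_le_of_sq_add_sq {l₁ l₂ : ℤ} {M : ℕ}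
    (h : (6 * l₁ + 1) ^ 2 + (6 * l₂ + 1) ^ 2 = 2 * (M : ℤ)) : l₁.natAbs ≤ M ∧ l₂.natAbs ≤ M := by
  have k1 : 2 * (l₁.natAbs : ℤ) ≤ (6 * l₁ + 1) ^ 2 := by
    rcases le_or_gt 0 l₁ with h0 | h0
    · rw [Int.natAbs_of_nonneg h0]; nlinarith
    · rw [Int.ofNat_natAbs_of_nonpos h0.le]; nlinarith
  have k2 : 2 * (l₂.natAbs : ℤ) ≤ (6 * l₂ + 1) ^ 2 := by
    rcases le_or_gt 0 l₂ with h0 | h0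
    · rw [Int.natAbs_of_nonneg h0]; nlinarith
    · rw [Int.ofNat_natAbs_of_nonpos h0.le]; nlinarith
  have k3 : 1 ≤ (6 * l₁ + 1) ^ 2 := by
    rcases le_or_gt 0 l₁ with h0 | h0 <;> nlinarith
  have k4 : 1 ≤ (6 * l₂ + 1) ^ 2 := by
    rcases le_or_gt 0 l₂ with h0 | h0 <;> nlinarith
  generalize (6 * l₁ + 1) ^ 2 = X at h k1 k3
  generalize (6 * l₂ + 1) ^ 2 = Y at h k2 k4
  constructor <;> omega

/-- **`[q^M] η(12z)² = Ξ(M)` for odd `M`**: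
`∑_{(6l₁+1)² + (6l₂+1)² = 2M} (-1)^{l₁+l₂} = ∑_{N δ = M, δ ≡ 1 (3)} χ'(δ)`, by
`(l₁, l₂) ↦ δ = (3(l₁+l₂)+1) + 3(l₂-l₁) i` (i.e. `a = 6l₁+1 = re δ - im δ`, `b = 6l₂+1 = re δ + im δ`,
`a² + b² = 2 N(δ)`, `χ₁₂(a)χ₁₂(b) = (-1)^{l₁+l₂} = χ'(δ)`). [folklore] -/
theorem sum_box_eq_xiG {M : ℕ} (hM : M % 2 = 1) :
    ∑ q ∈ (box M ×ˢ box M).filter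
        (fun q : ℤ × ℤ ↦ (6 * q.1 + 1) ^ 2 + (6 * q.2 + 1) ^ 2 = 2 * (M : ℤ)),
      (-1 : ℤ) ^ q.1.natAbs * (-1) ^ q.2.natAbs = xiG M := by
  rw [xiG]
  refine Finset.sum_nbij' (fun q ↦ (⟨3 * (q.1 + q.2) + 1, 3 * (q.2 - q.1)⟩ : ℤ[i]))
    (fun δ ↦ ((δ.re - δ.im - 1) / 6, (δ.re + δ.im - 1) / 6)) ?_ ?_ ?_ ?_ ?_
  · rintro ⟨l₁, l₂⟩ hq
    rw [Finset.mem_filter, Finset.mem_product] at hq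
    obtain ⟨-, h⟩ := hq
    rw [gSet, Finset.mem_filter, mem_normEq, Zsqrtd.norm_def]
    dsimp only at h ⊢
    refine ⟨by nlinarith [h], by omega, by omega⟩
  · intro δ hδ
    rw [gSet, Finset.mem_filter, mem_normEq] at hδ
    obtain ⟨hn, hre, him⟩ := hδ
    have hodd : (δ.re + δ.im) % 2 = 1 := parity_of_norm_odd hM hn
    have hnorm : δ.re * δ.re + δ.im * δ.im = M := by rw [← hn, Zsqrtd.norm_def]; ring
    have e1 : 6 * ((δ.re - δ.im - 1) / 6) + 1 = δ.re - δ.im := by omega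
    have e2 : 6 * ((δ.re + δ.im - 1) / 6) + 1 = δ.re + δ.im := by omega
    have heq : (6 * ((δ.re - δ.im - 1) / 6) + 1) ^ 2 + (6 * ((δ.re + δ.im - 1) / 6) + 1) ^ 2
        = 2 * (M : ℤ) := by
      rw [e1, e2]; linear_combination 2 * hnorm
    rw [Finset.mem_filter, Finset.mem_product, mem_box_iff_natAbs_le, mem_box_iff_natAbs_le]
    exact ⟨natAbs_le_of_sq_add_sq heq, heq⟩
  · rintro ⟨l₁, l₂⟩ -
    refine Prod.ext ?_ ?_ <;> dsimp only <;> omega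
  · intro δ hδ
    rw [gSet, Finset.mem_filter, mem_normEq] at hδ
    obtain ⟨hn, hre, him⟩ := hδ
    have hodd : (δ.re + δ.im) % 2 = 1 := parity_of_norm_odd hM hn
    ext <;> dsimp only <;> omega
  · rintro ⟨l₁, l₂⟩ -
    dsimp only
    rw [neg_one_pow_natAbs_mul_natAbs, xiTwo_mk_eq]

end Literature.NumberTheory.EllipticCurves.Tunnell1983.HeckeXi
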